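import Summits.CriticalPhenomena.PercolationContinuityZ3.Theorems.PercNearOneGluingNoHeavyLowerTailSahiCombTriWShell

/-!
# `TRI_W(a) ≥ 0` by induction on the dimension of the cube: the FACE-MINIMUM reduction

Support file of the one-cut programme (crux `NoHeavyLowerTail`, stmt-CriticalPhenomena-4575; cell `prim-masterthm`, seat P5 gen 17;
memo `FROM-prim-masterthm-p5-g17-FACE-MIN-INDUCTION.md`, report `P5-LORENTZIAN-TEST.md` §21).

`FiveUpSet.TriWIneq` (`…SahiCombTriWGeneral`) asks for `0 ≤ triW P F G` for every up-set `P` of a cube `Finset γ` and all monotone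
families `F, G : Finset β → up-sets of Finset γ`, for every index cube `Finset β` (`a = #β`; open for `a ≥ 2`).  Earlier seats recorded that
PLAIN induction on `n = #γ` is dead: the peel deficit `triW − [triW(bottom face) + triW(top face)]` along a coordinate `i` has both signs
(report §18.7, ttrl TRI.md §8).  This file isolates the statement that DOES make the induction run, found by exact census this generation:

  (FACE-MIN)  for every coordinate `i : γ`:  `min (triW P⁰ F⁰ G⁰) (triW P¹ F¹ G¹) ≤ triW P F G`,

where `(P⁰, F⁰, G⁰)` is the RESTRICTION of the instance to the bottom face `{s | i ∉ s}` and `(P¹, F¹, G¹)` the restriction to the top face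
`{s | i ∈ s}`, both read as instances on the cube over `{j // j ≠ i}` (antipode = complement inside `γ ∖ {i}`; `faceBot`, `faceTop` below).
Census (exact, C, this seat; `F ≤ G` by symmetry, all `i`): EXHAUSTIVE `(n,a) = (2,1), (3,1), (4,1)` [4,828,247,928 instances], `(2,2), (3,2)`
[574,791,420], `(2,3)` [172,437,426]: 0 violations; TIGHT (`min = triW` occurs with `min > 0`); each one-sided form (`triW ≥ bottom`, `triW ≥ top`,
`2·triW ≥ bottom + top`) FAILS, the last one first at `n = 4`.

* `faceLift`, `faceBot`, `faceTop` — the two faces of a family along a coordinate, as families over the smaller cube; they preserve up-sets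
  (`isUpperSet_faceBot/Top`) and monotonicity of indexed families (`faceBot_mono`, `faceTop_mono`);
* `FaceMinIneq` (`@[conjecture]`) — (FACE-MIN), typed;
* `refl_subset_self_of_isEmpty`, **`triW_nonneg_of_isEmpty`** — the base of the induction (`#γ = 0`: `refl P = P`, so the self-dual stratum
  `triW_nonneg_of_refl_subset` applies; this is Kleitman's lemma in the INDEX cube);
* **`triWIneq_of_faceMinIneq : FaceMinIneq → TriWIneq`** — the induction on `#γ` (for all cube types at once; the faces of a cube of
  dimension `n + 1` are cubes of dimension `n`, both face values are `≥ 0` by induction, and (FACE-MIN) bounds `triW` below by the smaller one).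
So `TriWIneq` for EVERY `a` is reduced to ONE statement comparing an instance with its two restrictions along a single coordinate.
HONEST LABEL: definitions, an unconditional base case and a PROVED reduction; `FaceMinIneq` itself is a CONJECTURE of this theory (census
above), not a fact, and `TriWIneq` remains OPEN. [this work]
-/

namespace Summit.CriticalPhenomena.PercolationContinuityZ3.Theorems

namespace FiveUpSet

open Finset

variable {β γ : Type} [DecidableEq β] [Fintype β] [DecidableEq γ] [Fintype γ]

/-! ### The two faces of a family along a coordinate -/

/-- The bottom-face embedding: a subset of `γ ∖ {i}` (a `Finset {j // j ≠ i}`) read as a subset of `γ` not containing `i`. [this work] -/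
def faceLift (i : γ) (s : Finset {j : γ // j ≠ i}) : Finset γ :=
  s.map (Function.Embedding.subtype _)

omit [DecidableEq γ] [Fintype γ] in
/-- `faceLift` is monotone. [this work] -/
theorem faceLift_mono (i : γ) : Monotone (faceLift i) :=
  fun _ _ h => map_subset_map.2 h

/-- The BOTTOM FACE of a family `𝒜` along `i`: `{s ⊆ γ ∖ {i} | s ∈ 𝒜}`, a family in the cube over `{j // j ≠ i}`. [this work] -/
def faceBot (i : γ) (𝒜 : Finset (Finset γ)) : Finset (Finset {j : γ // j ≠ i}) :=
  univ.filter (fun s => faceLift i s ∈ 𝒜)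

/-- The TOP FACE of a family `𝒜` along `i`: `{s ⊆ γ ∖ {i} | s ∪ {i} ∈ 𝒜}`, a family in the cube over `{j // j ≠ i}`. [this work] -/
def faceTop (i : γ) (𝒜 : Finset (Finset γ)) : Finset (Finset {j : γ // j ≠ i}) :=
  univ.filter (fun s => insert i (faceLift i s) ∈ 𝒜)

/-- Membership in the bottom face. [this work] -/
@[simp] theorem mem_faceBot (i : γ) (𝒜 : Finset (Finset γ)) (s : Finset {j : γ // j ≠ i}) :
    s ∈ faceBot i 𝒜 ↔ faceLift i s ∈ 𝒜 := by
  simp [faceBot]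

/-- Membership in the top face. [this work] -/
@[simp] theorem mem_faceTop (i : γ) (𝒜 : Finset (Finset γ)) (s : Finset {j : γ // j ≠ i}) :
    s ∈ faceTop i 𝒜 ↔ insert i (faceLift i s) ∈ 𝒜 := by
  simp [faceTop]

/-- The bottom face of an up-set is an up-set. [this work] -/
theorem isUpperSet_faceBot (i : γ) {𝒜 : Finset (Finset γ)} (h : IsUpperSet (𝒜 : Set (Finset γ))) :
    IsUpperSet (faceBot i 𝒜 : Set (Finset {j : γ // j ≠ i})) := by
  intro s t hst hs
  rw [mem_coe, mem_faceBot] at hs ⊢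
  exact h (faceLift_mono i hst) hs

/-- The top face of an up-set is an up-set. [this work] -/
theorem isUpperSet_faceTop (i : γ) {𝒜 : Finset (Finset γ)} (h : IsUpperSet (𝒜 : Set (Finset γ))) :
    IsUpperSet (faceTop i 𝒜 : Set (Finset {j : γ // j ≠ i})) := by
  intro s t hst hs
  rw [mem_coe, mem_faceTop] at hs ⊢
  exact h (insert_subset_insert i (faceLift_mono i hst)) hs

/-- `faceBot i` is monotone in the family (so it maps monotone indexed families to monotone indexed families). [this work] -/
theorem faceBot_mono (i : γ) : Monotone (faceBot i) := by
  intro 𝒜 ℬ h s hs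
  rw [mem_faceBot] at hs ⊢
  exact h hs

/-- `faceTop i` is monotone in the family. [this work] -/
theorem faceTop_mono (i : γ) : Monotone (faceTop i) := by
  intro 𝒜 ℬ h s hs
  rw [mem_faceTop] at hs ⊢
  exact h hs

/-! ### The face-minimum statement -/

/-- **(FACE-MIN)** (CONJECTURE — an obligation of our theory, never a fact; census in the file header).  For every coordinate `i` of the cube,
every up-set `P` and all monotone families of up-sets `F, G` over any index cube:
`min (triW P⁰ F⁰ G⁰) (triW P¹ F¹ G¹) ≤ triW P F G`, the superscripts denoting restriction to the bottom / top face along `i`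
(`faceBot`, `faceTop`).  Implies `TriWIneq` for every index cube (`triWIneq_of_faceMinIneq`). [this work] -/
@[conjecture] def FaceMinIneq : Prop :=
  ∀ (β γ : Type) [DecidableEq β] [Fintype β] [DecidableEq γ] [Fintype γ]
    (i : γ) (P : Finset (Finset γ)) (F G : Finset β → Finset (Finset γ)),
    IsUpperSet (P : Set (Finset γ)) → (∀ x, IsUpperSet (F x : Set (Finset γ))) → (∀ x, IsUpperSet (G x : Set (Finset γ))) →
    Monotone F → Monotone G →
      min (triW (faceBot i P) (fun x => faceBot i (F x)) (fun x => faceBot i (G x)))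
          (triW (faceTop i P) (fun x => faceTop i (F x)) (fun x => faceTop i (G x))) ≤ triW P F G

/-! ### Base of the induction: the zero-dimensional cube -/

/-- In the zero-dimensional cube every set equals its complement, so `refl P ⊆ P`. [this work] -/
theorem refl_subset_self_of_isEmpty [IsEmpty γ] (P : Finset (Finset γ)) : refl P ⊆ P := by
  intro s hs
  rw [mem_refl] at hs
  have h1 : sᶜ = (∅ : Finset γ) := Finset.eq_empty_of_isEmpty _
  have h2 : s = (∅ : Finset γ) := Finset.eq_empty_of_isEmpty _
  rw [h1, ← h2] at hs
  exact hs

/-- **Base case**: over the zero-dimensional cube, `0 ≤ triW P F G` for monotone families of up-sets (the self-dual stratum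
`triW_nonneg_of_refl_subset`; in substance Kleitman's lemma in the index cube). [this work] -/
theorem triW_nonneg_of_isEmpty [IsEmpty γ] (P : Finset (Finset γ)) (F G : Finset β → Finset (Finset γ))
    (hP : IsUpperSet (P : Set (Finset γ))) (hF : ∀ x, IsUpperSet (F x : Set (Finset γ)))
    (hG : ∀ x, IsUpperSet (G x : Set (Finset γ))) (hFm : Monotone F) (hGm : Monotone G) :
    0 ≤ triW P F G :=
  triW_nonneg_of_refl_subset P F G hP hF hG hFm hGm (refl_subset_self_of_isEmpty P)

/-! ### The induction -/

/-- Removing one point lowers the cardinality by one: `#{j // j ≠ i} = #γ − 1`. [folklore] -/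
theorem card_subtype_ne (i : γ) : Fintype.card {j : γ // j ≠ i} = Fintype.card γ - 1 := by
  rw [Fintype.card_subtype, filter_ne', card_erase_of_mem (mem_univ i), card_univ]

/-- **`FaceMinIneq → TriWIneq`**: (FACE-MIN) implies `TRI_W(a) ≥ 0` for EVERY index cube, by induction on the dimension of the cube
(all cube types at once): both faces of an `(n+1)`-dimensional instance are `n`-dimensional instances (up-sets and monotone families
restrict), hence `≥ 0` by induction, and (FACE-MIN) bounds `triW` below by the smaller of the two. [this work] -/
theorem triWIneq_of_faceMinIneq (h : FaceMinIneq) : TriWIneq := by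
  intro β γ _ _ _ _ P F G hP hF hG hFm hGm
  suffices key : ∀ (n : ℕ) (γ : Type) [DecidableEq γ] [Fintype γ], Fintype.card γ = n →
      ∀ (P : Finset (Finset γ)) (F G : Finset β → Finset (Finset γ)),
        IsUpperSet (P : Set (Finset γ)) → (∀ x, IsUpperSet (F x : Set (Finset γ))) →
        (∀ x, IsUpperSet (G x : Set (Finset γ))) → Monotone F → Monotone G → 0 ≤ triW P F G from
    key _ γ rfl P F G hP hF hG hFm hGm
  intro n
  induction n with
  | zero =>
    intro γ _ _ hcard P F G hP hF hG hFm hGm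
    haveI : IsEmpty γ := Fintype.card_eq_zero_iff.1 hcard
    exact triW_nonneg_of_isEmpty P F G hP hF hG hFm hGm
  | succ n ih =>
    intro γ _ _ hcard P F G hP hF hG hFm hGm
    have hne : Nonempty γ := Fintype.card_pos_iff.1 (by omega)
    obtain ⟨i⟩ := hne
    have hmin := h β γ i P F G hP hF hG hFm hGm
    have hcard' : Fintype.card {j : γ // j ≠ i} = n := by
      rw [card_subtype_ne, hcard, Nat.add_sub_cancel]
    have hB : 0 ≤ triW (faceBot i P) (fun x => faceBot i (F x)) (fun x => faceBot i (G x)) :=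
      ih {j : γ // j ≠ i} hcard' _ _ _ (isUpperSet_faceBot i hP) (fun x => isUpperSet_faceBot i (hF x))
        (fun x => isUpperSet_faceBot i (hG x)) (fun x y hxy => faceBot_mono i (hFm hxy))
        (fun x y hxy => faceBot_mono i (hGm hxy))
    have hU : 0 ≤ triW (faceTop i P) (fun x => faceTop i (F x)) (fun x => faceTop i (G x)) :=
      ih {j : γ // j ≠ i} hcard' _ _ _ (isUpperSet_faceTop i hP) (fun x => isUpperSet_faceTop i (hF x))
        (fun x => isUpperSet_faceTop i (hG x)) (fun x y hxy => faceTop_mono i (hFm hxy))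
        (fun x y hxy => faceTop_mono i (hGm hxy))
    exact (le_min hB hU).trans hmin

/-! ### The existential form (appended 2026-08-21, same seat, after the kit census j140111)

CENSUS UPDATE — READ THIS: the universal form `FaceMinIneq` above ("for EVERY coordinate `i`") is **REFUTED** at `(n,a) = (5,1)`
(thin edge, `#β = 1`, `#γ = 5`): kit j140111 (structured sampler, 7.6e8 instances of that cell) found 3 instances with ONE bad coordinate,
e.g. `P = 0xfaa0e000 ⊆ 2^5`, `F = 0xfffcfeecffececa8`, `G = 0xa0a0a0a0a0a0a0a0 ⊆ 2^1 × 2^5` (bit `z` of the mask = point `z = x + 2w`), `i = 4`: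
`triW = 1`, bottom face `2`, top face `2` (the other four coordinates satisfy the inequality; verified independently, memo
`FROM-prim-masterthm-p5-g17-FACE-MIN-INDUCTION.md` §7).  It holds exhaustively on every cell with `n ≤ 4` tested and on 6.7e8 / 6e8 / 6e8 sampled
instances of `(4,2)`, `(3,3)`, `(2,4)`.  What the induction actually needs is only the EXISTENTIAL form below (some coordinate works), which has
0 failures on all 2.63e9 instances of j140111 and on all exhaustive cells (every instance has a coordinate with `triW ≥ triW(bottom face)`).
`FaceMinIneq` is kept (declarations are append-only) but should be read as FALSE; use `FaceMinExistsIneq`. -/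

/-- **(FACE-MIN-∃)** (CONJECTURE — an obligation of our theory, never a fact).  For every cube with at least one coordinate, every up-set `P` and
all monotone families of up-sets `F, G` over any index cube, SOME coordinate `i` satisfies
`min (triW P⁰ F⁰ G⁰) (triW P¹ F¹ G¹) ≤ triW P F G` (faces along `i`).  Census: 0 failures on 2.63e9 sampled instances of `(n,a) = (5,1), (4,2), (3,3), (2,4)`
(kit j140111) and on the exhaustive cells `(2,1), (3,1), (4,1), (2,2), (3,2), (2,3)`; the universal form `FaceMinIneq` is false at `(5,1)` (see above).
Implies `TriWIneq` for every index cube (`triWIneq_of_faceMinExistsIneq`). [this work] -/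
@[conjecture] def FaceMinExistsIneq : Prop :=
  ∀ (β γ : Type) [DecidableEq β] [Fintype β] [DecidableEq γ] [Fintype γ]
    (P : Finset (Finset γ)) (F G : Finset β → Finset (Finset γ)), Nonempty γ →
    IsUpperSet (P : Set (Finset γ)) → (∀ x, IsUpperSet (F x : Set (Finset γ))) → (∀ x, IsUpperSet (G x : Set (Finset γ))) →
    Monotone F → Monotone G →
      ∃ i : γ, min (triW (faceBot i P) (fun x => faceBot i (F x)) (fun x => faceBot i (G x)))
          (triW (faceTop i P) (fun x => faceTop i (F x)) (fun x => faceTop i (G x))) ≤ triW P F G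

/-- The universal form trivially implies the existential one (recorded for the logical map; the universal form is refuted by census). [this work] -/
theorem faceMinExistsIneq_of_faceMinIneq (h : FaceMinIneq) : FaceMinExistsIneq := by
  intro β γ _ _ _ _ P F G hne hP hF hG hFm hGm
  obtain ⟨i⟩ := hne
  exact ⟨i, h β γ i P F G hP hF hG hFm hGm⟩

/-- **`FaceMinExistsIneq → TriWIneq`**: the existential face-minimum statement already drives the induction on the dimension of the cube
(both faces of the chosen coordinate are instances of one dimension less, hence `≥ 0` by induction). [this work] -/
theorem triWIneq_of_faceMinExistsIneq (h : FaceMinExistsIneq) : TriWIneq := by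
  intro β γ _ _ _ _ P F G hP hF hG hFm hGm
  suffices key : ∀ (n : ℕ) (γ : Type) [DecidableEq γ] [Fintype γ], Fintype.card γ = n →
      ∀ (P : Finset (Finset γ)) (F G : Finset β → Finset (Finset γ)),
        IsUpperSet (P : Set (Finset γ)) → (∀ x, IsUpperSet (F x : Set (Finset γ))) →
        (∀ x, IsUpperSet (G x : Set (Finset γ))) → Monotone F → Monotone G → 0 ≤ triW P F G from
    key _ γ rfl P F G hP hF hG hFm hGm
  intro n
  induction n with
  | zero =>
    intro γ _ _ hcard P F G hP hF hG hFm hGm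
    haveI : IsEmpty γ := Fintype.card_eq_zero_iff.1 hcard
    exact triW_nonneg_of_isEmpty P F G hP hF hG hFm hGm
  | succ n ih =>
    intro γ _ _ hcard P F G hP hF hG hFm hGm
    have hne : Nonempty γ := Fintype.card_pos_iff.1 (by omega)
    obtain ⟨i, hmin⟩ := h β γ P F G hne hP hF hG hFm hGm
    have hcard' : Fintype.card {j : γ // j ≠ i} = n := by
      rw [card_subtype_ne, hcard, Nat.add_sub_cancel]
    have hB : 0 ≤ triW (faceBot i P) (fun x => faceBot i (F x)) (fun x => faceBot i (G x)) :=
      ih {j : γ // j ≠ i} hcard' _ _ _ (isUpperSet_faceBot i hP) (fun x => isUpperSet_faceBot i (hF x))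
        (fun x => isUpperSet_faceBot i (hG x)) (fun x y hxy => faceBot_mono i (hFm hxy))
        (fun x y hxy => faceBot_mono i (hGm hxy))
    have hU : 0 ≤ triW (faceTop i P) (fun x => faceTop i (F x)) (fun x => faceTop i (G x)) :=
      ih {j : γ // j ≠ i} hcard' _ _ _ (isUpperSet_faceTop i hP) (fun x => isUpperSet_faceTop i (hF x))
        (fun x => isUpperSet_faceTop i (hG x)) (fun x y hxy => faceTop_mono i (hFm hxy))
        (fun x y hxy => faceTop_mono i (hGm hxy))
    exact (le_min hB hU).trans hmin

end FiveUpSet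

end Summit.CriticalPhenomena.PercolationContinuityZ3.Theorems
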